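import Mathlib
import HarnessLib
import Summits.HubbardSuperconductivity.HubbardSuperconductivity.Theorems.KLProgrammeKLRegimeSplitTwoLegSizesZeroFromPosition
import Summits.HubbardSuperconductivity.HubbardSuperconductivity.Theorems.KLProgrammeKLRegimeSplitTwoLegPieceFnEval

/-!
# Route `KLProgramme` — gen-5 ENGINE child, two-leg stubs: the (E3a) TIER-1 CONJUNCTS of the slot, LITERALLY, from position-space moments —
# `ContDiff ℝ 4 (onM piece) ∧ ∀ j ≤ 2, ‖Dʲ onM piece‖ ≤ twoLegBar … j n` for the pieces `ℓ_{n+1}(K.eval)` and `ℓ_0(K.eval)` in the KL regime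

Cell `gate-hubbard-kl`, seat p1b (g6); plan g12 audit GEN5-AUDIT §5 row T-a1 (the tier-1 conjuncts 1–2 of `TwoLegSizesFn … K.eval`, kept under V13 and
V13b alike).  `…TwoLegSizesFromPosition` (p486962/p487064) and `…TwoLegSizesZeroFromPosition` (p487292) give the explicit derivative bounds of the pieces
from position-space moments; k3c3-p1's `twoLegPieceFn_eval_smooth_symmetric_of_frameOK` (p483547) gives `ContDiff`.  Here the two are combined in the
regime binder shape with the engine's two remaining duties as hypotheses — the moment numbers and the FIT of the explicit bound into `twoLegBar`:

* **`twoLegSizes_tier1_succ_of_position_moments`**: `∃ c₃ U₀ > 0`, regime ⇒ `∃ D ≥ 1`, `∀ μ ∈ klWindowC`, `∀ K` admissible, all `(L, M, G, Q, n)`, moments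
  `Mˢ k` (`k ≤ 4`) of the increment kernel, numerals `X` (`l ≤ 2`), fit (`j ≤ 2`) ⇒
  `ContDiff ℝ 4 (onM ℓ_{n+1}(K.eval)) ∧ ∀ j ≤ 2, ∀ q, ‖Dʲ onM ℓ_{n+1}(K.eval) q‖ ≤ twoLegBar G Q U j (n+1)`;
* **`twoLegSizes_tier1_zero_of_position_moments`**: the same for `ℓ_0` with the scale-`0` kernel moments and the frame's `C⁴` sizes
  (`norm_iteratedFDeriv_frameShift_le_of_frameOK_four`).

Proofs only; nothing about the model is asserted.  References: BGM 2006 (2.36) [cite: BenfattoGiulianiMastropietro2006].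
-/

noncomputable section

namespace Summit.HubbardSuperconductivity.HubbardSuperconductivity.Theorems.KLRegimeSplit

set_option linter.dupNamespace false -- summit = problem name (single-conjunct summit), D-0017

open Real Finset
open Literature.MathematicalPhysics.QuantumLattice Literature.MathematicalPhysics.QuantumLattice.BandSectorCounting
open Literature.Probability.LatticeModels
open Summit.HubbardSuperconductivity.HubbardSuperconductivity.Theorems.DispersionFlow
open Summit.HubbardSuperconductivity.HubbardSuperconductivity.Theorems.PerturbedFermiCurve
open Summit.HubbardSuperconductivity.HubbardSuperconductivity.Theorems.KLProgrammeLegKernels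
open Summit.HubbardSuperconductivity.HubbardSuperconductivity.Theorems.TwoLegFourier

section Model

/-- **(E3a) TIER 1 for `ℓ_{n+1}(K.eval)` in the KL regime, literally**: smoothness + the `j ≤ 2` derivative bounds against `twoLegBar`, from the
increment kernel moments, the cutoff numerals and the fit of `…SizesFromPosition`'s explicit bound. -/
theorem twoLegSizes_tier1_succ_of_position_moments (R : RenConsts) (hR : ∀ j, 0 ≤ R.Gfr j) :
    ∃ c₃ : ℝ, 0 < c₃ ∧ ∃ U₀ : ℝ, 0 < U₀ ∧
      ∀ c : ℝ, 0 < c → c ≤ c₃ → ∀ U : ℝ, 0 < U → U ≤ U₀ → ∀ β : ℝ, klBetaMin ≤ β → β ≤ Real.exp (c / U ^ 2) →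
      ∃ D : ℝ, 1 ≤ D ∧ ∀ μ ∈ klWindowC, ∀ K : TrigPolyC4v, FrameOK R U (nScales β) μ K →
        ∀ (L M : ℕ) [NeZero L] [NeZero M] (G : GeoConsts) (Q : EngConsts) (n : ℕ) (Ms : ℕ → ℝ) (X : ℝ),
          (∀ k ≤ 4, ∀ (σ : Fin 2) (x₀ : SpaceTimeIdx L M), imagTimeWeight β M *
            ∑ x ∈ (univ : Finset (Fin 2 → SpaceTimeIdx L M)).filter (fun x => x 0 = x₀),
              (1 + ((((x 1).2 - (x 0).2) 0).valMinAbs.natAbs : ℝ) + ((((x 1).2 - (x 0).2) 1).valMinAbs.natAbs : ℝ)) ^ k *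
                ‖sectorisedKernel L M β (trivialMultiplier L M) (klEffectiveAction L M β U μ K klE0 (n + 1)) 2
                    (![((0, σ), 0), ((0, σ), 1)] : Fin 2 → SectorLeg 1) x -
                  sectorisedKernel L M β (trivialMultiplier L M) (klEffectiveAction L M β U μ K klE0 n) 2
                    (![((0, σ), 0), ((0, σ), 1)] : Fin 2 → SectorLeg 1) x‖ ≤ Ms k) →
          (∀ l ≤ 2, ∀ x : ℝ, ‖iteratedFDeriv ℝ l salmhoferCutoff x‖ ≤ X) →
          (∀ j ≤ 2, (if j = 0 then 2 * Ms 0 else 0) +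
              (j.factorial : ℝ) ^ 2 * (2 * j.factorial * X * 200 ^ j) *
                (4 * Ms 0 + 14 * (∑ k ∈ Icc 1 4, Ms k) * (max D 1) ^ 4) * (4 + max 1 (((j - 1).factorial : ℝ) / (8 / 5))) ^ j ≤
            twoLegBar G Q U j (n + 1)) →
          ContDiff ℝ 4 (onM (klTwoLegPieceFn L M β U μ K.eval (n + 1))) ∧
            ∀ j ≤ 2, ∀ q : Momentum, ‖iteratedFDeriv ℝ j (onM (klTwoLegPieceFn L M β U μ K.eval (n + 1))) q‖ ≤ twoLegBar G Q U j (n + 1) := by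
  obtain ⟨c₁, hc₁, U₁, hU₁, hsz⟩ := norm_iteratedFDeriv_onM_pieceFn_eval_succ_le_of_frameOK_regime R hR
  obtain ⟨c₂, hc₂, U₂, hU₂, hsm⟩ := twoLegPieceFn_eval_smooth_symmetric_of_frameOK R hR
  refine ⟨min c₁ c₂, lt_min hc₁ hc₂, min U₁ U₂, lt_min hU₁ hU₂, ?_⟩
  intro c hc hcle U hU hUle β hβmin hβc
  obtain ⟨D, hD1, hD⟩ := hsz c hc (hcle.trans (min_le_left _ _)) U hU (hUle.trans (min_le_left _ _)) β hβmin hβc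
  refine ⟨D, hD1, fun μ hμ K hK L M _ _ G Q n Ms X hMs hX hfit => ⟨?_, fun j hj q => ?_⟩⟩
  · have h := hsm c hc (hcle.trans (min_le_right _ _)) U hU (hUle.trans (min_le_right _ _)) β hβmin hβc μ hμ μ K hK L M (n + 1)
    exact_mod_cast h.2 4
  · have hj4 : j ≤ 4 := hj.trans (by norm_num)
    exact (hD μ hμ K hK L M n Ms hMs j hj4 X (fun l hl x => hX l (hl.trans hj) x) q).trans (hfit j hj)

/-- **(E3a) TIER 1 for the scale-`0` piece `ℓ_0(K.eval)` in the KL regime, literally**, from the scale-`0` kernel moments, the frame's `C⁴` sizes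
(`A′_k = (N+1)·Gfr_k·uPow_k U·4^{2N}`, `N = nScales β`), the cutoff numerals and the fit of `…SizesZeroFromPosition`'s explicit bound. -/
theorem twoLegSizes_tier1_zero_of_position_moments (R : RenConsts) (hR : ∀ j, 0 ≤ R.Gfr j) :
    ∃ c₃ : ℝ, 0 < c₃ ∧ ∃ U₀ : ℝ, 0 < U₀ ∧
      ∀ c : ℝ, 0 < c → c ≤ c₃ → ∀ U : ℝ, 0 < U → U ≤ U₀ → ∀ β : ℝ, klBetaMin ≤ β → β ≤ Real.exp (c / U ^ 2) →
      ∃ D : ℝ, 1 ≤ D ∧ ∀ μ ∈ klWindowC, ∀ K : TrigPolyC4v, FrameOK R U (nScales β) μ K →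
        ∀ (L M : ℕ) [NeZero L] [NeZero M] (G : GeoConsts) (Q : EngConsts) (Ms : ℕ → ℝ) (X : ℝ),
          (∀ k ≤ 4, ∀ (σ : Fin 2) (x₀ : SpaceTimeIdx L M), imagTimeWeight β M *
            ∑ x ∈ (univ : Finset (Fin 2 → SpaceTimeIdx L M)).filter (fun x => x 0 = x₀),
              (1 + ((((x 1).2 - (x 0).2) 0).valMinAbs.natAbs : ℝ) + ((((x 1).2 - (x 0).2) 1).valMinAbs.natAbs : ℝ)) ^ k *
                ‖sectorisedKernel L M β (trivialMultiplier L M) (klEffectiveAction L M β U μ K klE0 0) 2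
                  (![((0, σ), 0), ((0, σ), 1)] : Fin 2 → SectorLeg 1) x‖ ≤ Ms k) →
          (∀ l ≤ 2, ∀ x : ℝ, ‖iteratedFDeriv ℝ l salmhoferCutoff x‖ ≤ X) →
          (∀ j ≤ 2, (if j = 0 then 2 * Ms 0 + ((nScales β : ℝ) + 1) * R.Gfr 0 * uPow 0 U * (4 : ℝ) ^ (2 * nScales β) else 0) +
              (j.factorial : ℝ) ^ 2 * (2 * j.factorial * X * 200 ^ j) *
                (2 * (2 * Ms 0 + ((nScales β : ℝ) + 1) * R.Gfr 0 * uPow 0 U * (4 : ℝ) ^ (2 * nScales β)) +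
                  7 * (∑ k ∈ Icc 1 4, (2 * Ms k + ((nScales β : ℝ) + 1) * R.Gfr k * uPow k U * (4 : ℝ) ^ (2 * nScales β))) * (max D 1) ^ 4) *
                (4 + max 1 (((j - 1).factorial : ℝ) / (8 / 5))) ^ j ≤
            twoLegBar G Q U j 0) →
          ContDiff ℝ 4 (onM (klTwoLegPieceFn L M β U μ K.eval 0)) ∧
            ∀ j ≤ 2, ∀ q : Momentum, ‖iteratedFDeriv ℝ j (onM (klTwoLegPieceFn L M β U μ K.eval 0)) q‖ ≤ twoLegBar G Q U j 0 := by
  have ha : (-4 : ℝ) < -1.1 := by norm_num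
  have hab : (-1.1 : ℝ) ≤ -0.1 := by norm_num
  have hb : (-0.1 : ℝ) < 0 := by norm_num
  set B := bandBounds ha hab hb with hBdef
  have hDt := B.Dtmin_pos
  set κ : ℝ := min B.Dtmin (1 / 5) with hκdef
  have hκ : 0 < κ := lt_min hDt (by norm_num)
  obtain ⟨c₁, hc₁, U₁, hU₁, hthr⟩ := frame_thresholds hR hκ
  obtain ⟨c₂, hc₂, U₂, hU₂, hcurve⟩ := fermiPointLp_C4_of_frameOK R hR
  obtain ⟨c₄, hc₄, U₄, hU₄, hsm⟩ := twoLegPieceFn_eval_smooth_symmetric_of_frameOK R hR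
  refine ⟨min (min c₁ c₂) c₄, lt_min (lt_min hc₁ hc₂) hc₄, min (min U₁ U₂) U₄, lt_min (lt_min hU₁ hU₂) hU₄, ?_⟩
  intro c hc hcle U hU hUle β hβmin hβc
  have hc1 : c ≤ c₁ := hcle.trans ((min_le_left _ _).trans (min_le_left _ _))
  have hc2 : c ≤ c₂ := hcle.trans ((min_le_left _ _).trans (min_le_right _ _))
  have hc4 : c ≤ c₄ := hcle.trans (min_le_right _ _)
  have hU1 : U ≤ U₁ := hUle.trans ((min_le_left _ _).trans (min_le_left _ _))
  have hU2 : U ≤ U₂ := hUle.trans ((min_le_left _ _).trans (min_le_right _ _))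
  have hU4 : U ≤ U₄ := hUle.trans (min_le_right _ _)
  obtain ⟨D, hD1, hD⟩ := hcurve c hc hc2 U hU hU2 β hβmin hβc
  refine ⟨D, hD1, fun μ hμ K hK L M _ _ G Q Ms X hMs hX hfit => ⟨?_, fun j hj q => ?_⟩⟩
  · have h := hsm c hc hc4 U hU hU4 β hβmin hβc μ hμ μ K hK L M 0
    exact_mod_cast h.2 4
  · have hβ : 0 < β := lt_of_lt_of_le (by unfold klBetaMin; norm_num) hβmin
    have hAf : ∀ p : Momentum, ∀ j ≤ 2, ‖iteratedFDeriv ℝ j (frameShift K) p‖ ≤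
        2 * R.Gfr 0 * |U| + 2 * R.Gfr 1 * U ^ 2 + R.Gfr 2 * (c / Real.log 4) := fun p j hj =>
      norm_iteratedFDeriv_frameShift_le_of_frameOK_regime hR hc.le hβmin hβc hK p hj
    set A := 2 * R.Gfr 0 * |U| + 2 * R.Gfr 1 * U ^ 2 + R.Gfr 2 * (c / Real.log 4) with hAdef
    have h4A : 4 * A ≤ κ := hthr c U hc.le hc1 hU hU1
    have hA0 : 0 ≤ A := le_trans (norm_nonneg _) (hAf 0 0 (by norm_num))
    have hκDt : κ ≤ B.Dtmin := min_le_left _ _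
    have hκ5 : κ ≤ 1 / 5 := min_le_right _ _
    have hADt : 2 * A < B.Dtmin := by linarith
    have hA20 : A ≤ 1 / 20 := by linarith
    obtain ⟨hlo, hhi⟩ := klWindowC_margin hμ hA20
    obtain ⟨hγ, hDer⟩ := hD μ hμ K hK
    have hA' : ∀ p : Momentum, ∀ k ≤ 4, ‖iteratedFDeriv ℝ k (frameShift K) p‖ ≤
        ((nScales β : ℝ) + 1) * R.Gfr k * uPow k U * (4 : ℝ) ^ (2 * nScales β) := fun p k hk =>
      norm_iteratedFDeriv_frameShift_le_of_frameOK_four hR hK p hk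
    have hj4 : j ≤ 4 := hj.trans (by norm_num)
    exact (norm_iteratedFDeriv_onM_pieceFn_eval_zero_le_of_position_moments B hAf hADt hlo hhi hβ hμ hA' hMs hγ hDer hj4
      (fun l hl x => hX l (hl.trans hj) x) q).trans (hfit j hj)

end Model

end Summit.HubbardSuperconductivity.HubbardSuperconductivity.Theorems.KLRegimeSplit

end
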